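import Summits.QuantumFields.YangMills.Theorems.BalabanUVNodesN15CovariantLandauTwoGridGrad
import Summits.QuantumFields.YangMills.Theorems.BalabanUVNodesN15CovariantLandauFlatTwoGridRowBackKing
import HarnessLib

/-!
# Route «BalabanUVNodes», node N15 = NE2, road (c) — THE FLAT ROWS OF THE BACKWARD GRADIENT KERNEL `S̄ₕ∂G′(1)` OF n15-c∕237, ONE GRID AND TWO GRIDS, HYPOTHESIS-FREE ON KING's TORUS
# FAMILY — n15-c∕237's displayed flat inputs `hD1b`, `hD1b′` (`C_D̄`, `C_D̄′`) and `hDDb` (`ε_D̄`) LITERALLY, from n15-c∕220's `∂G′(1)` row (one back shift along the bond's own direction costs `e^{δ}`)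
# and from (Ξ-2)'s scalar core (King's (3.73) two-spacing rate of the backward piece, massless), bundled over bond directions and tensored with `1_ι` (dag-n15-a g34, (Ξ-3))

Cell `pub-ymgap`, seat `pub-ymgap-dag-n15-a` (generation g34; KNIT-BY-NAME lane; HUMAN RULING D-0062; chair R424 venue).  `bears_on: R4∕N15 · K3⁸ SpineGivenEndpointR13SepCoPHV
(stmt-QuantumFields-27366)`; filed `--supports stmt-QuantumFields-27366 --as helper` — COUNT-NEUTRAL.  Theorems only; 0 `sorry`; HYPOTHESIS-FREE on King's torus family `M_μ = 2L^e`, runs `L^K`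
(`K ≥ 1`) and `L^nL^K` (`n ≥ 1`), `L` odd `≥ 3`, `a₀ > 0`, rate exponent `0 < γ < 1∕2`.  Imports BY NAME: n15-c∕237 `…CovariantLandauTwoGridGrad` (`bBack` = the back shift `S̄ₕ` of bond fields along
their own direction, `bBack_mulVec`; through it n15-c∕220 `flatKernelRows_king` + dictionary `cGreen_one`, `cgrad_one`, `greenFlat_eq_fineOp_inv`, n15-c g3 `tdistT_blockOf_sub_unitVec_le`), (Ξ-2)
`…CovariantLandauFlatTwoGridRowBackKing` (★★★ `flatTwoGridRow_gradBack_king_scalar`, `kingDOp_zero_apply_eq_gradFlat`; through it (Ξ-1) `gradFlat_mulVec_apply`, dag-n15-e `kingDOp_apply`,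
`addRight_symm_apply'`).  Nothing in the tree is modified.

WHY.  n15-c∕237 `hasMaj_idef_cgrad_cGreen_of_flat` (the two-grid η-defect of `∂G′(T)`) displays, beside (Ξ-1)'s `ε_D` (`hDD`) and 220's rows, THREE flat rows of the backward-gradient kernel
`S̄ₕ∂G′(1) = bBack·∂·G′(1)`: one-grid rows on the coarse and the fine run (`hD1b`, `hD1b′`) and the flat two-grid row `hDDb` through King's pairings (`P̂_S` on scalars, `P̂_V` on bonds).  THIS FILE
proves all three on King's torus family at the paired couplings `a_K(a₀,L,K)·(L^K)^{d+1}` ∕ `a_{n+K}(a₀,L,n+K)·(L^nL^K)^{d+1}`: §1 reads the bond-colour field `(S̄ₕ∂G′(1)f)((x, μ), i)` as the rung's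
massless backward piece `(S_{−μ}D_μ f_i)(x)` on the colour slice `f_i`; §2 ONE GRID: the `∂G′(1)` row (n15-c∕220) read one step back — the output block moves by at most one unit (`|B(x−e_μ) −
B(x)|_T ≤ 1`), cost `e^{δ}`; §3 TWO GRIDS: (Ξ-2)'s scalar core at `κ = μ`, slice by slice, the defect of the bundled operator being the bundle of the slices' defects.
* §1 `bBack_cgrad_cGreen_mulVec_apply` (component dictionary), `loc_slice_le` (a colour slice's block size is at most the field's);
* §2 ★★★ `flatKernelRow_gradBack_king` — `∃ C δ > 0 ∀ K ≥ 1 ∀ N = L^K ∀ e (M = 2L^e) ∀ k ι`: `HasMaj (ofBlocks (unitTorusGeo L k M) (liftBlk (blockOf N M) ι)) (ofBlocks … (liftBlk (blockOf N M ∘ fst) ι))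
  (mulVecLin (bBack M N * (cgrad M N 1 * cGreen M N 1 (a_K·N^{d+1})))) (C·e^{−δ|y−y′|_T})` (= `hD1b` at `K := k`, `hD1b′` at `K := m + k`, `N := L^mL^k`);
* §3 ★★★ `flatTwoGridRow_gradBack_king` — `∃ C δ > 0 ∀ K ≥ 1 ∀ n ≥ 1 ∀ e (M = 2L^e) ∀ ι`: `hDDb`'s operator `idef (pull (liftMap (kingPr L K n M) ι)) (pull (liftMap (kingPrV L K n M) ι))
  (mulVecLin (bBack″ * (∂″ * G″(1)))) (mulVecLin (bBack′ * (∂′ * G′(1))))` has the block majorant `C·(L^K)^{−γ}·e^{−δ|y−y′|_T}` between the sharp unit-block sizes of `unitTorusGeo L K M`.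

HONEST FRAMING ∕ LIMITS.  King's `A = 0` MODEL statements ([King1986] template literature, typed and proved in the tree by dag-n15-e; n15-c∕220's one-grid rows) read at `m² = 0` on Bałaban's flat
objects at `U ≡ 1`; periodic b.c., `K, n ≥ 1`, tori `2L^e`, odd `L ≥ 3`, `0 < γ < 1∕2`, King's PAIRED couplings; the two-grid row is stated at the geometry label of the COARSE level (`unitTorusGeo L K M`,
n15-c∕237's `k`); NOT [Balaban1985BackgroundPropagators] Thm 3.1 as printed; NE2⁺ NOT PRINTED; N15 of record untouched (DISCHARGED AS CONSUMED, p687738); counts UNMOVED (typed 28∕28 · discharged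
8∕27); one finite 𝕋⁴ at fixed ε per index — NOT infinite volume ∕ OS ∕ mass gap ∕ Clay.  Restate-immune (no Theses import).  No `sorry`, `instance`, `notation`; standard axioms.
-/

noncomputable section

open scoped BigOperators Matrix Kronecker

namespace Summit.QuantumFields.YangMills.BalabanUVNodes.N15.CovLandau

open Literature.MathematicalPhysics.QuantumFieldTheory.Balaban1983to89
open Literature.MathematicalPhysics.QuantumFieldTheory.Balaban1983to89.B5Prop11Plancherel (Tor fine unitVec)
open Literature.MathematicalPhysics.QuantumFieldTheory.Balaban1983to89.B11SectG (BlockNorm HasMaj)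
open Literature.MathematicalPhysics.QuantumFieldTheory.Balaban1983to89.B11AxialTransport190 (abs_le_loc_ofBlocks loc_ofBlocks_le)
open Literature.MathematicalPhysics.QuantumFieldTheory.Balaban1983to89.B6UnitTorusCarrier (unitTorusGeo)
open Literature.MathematicalPhysics.QuantumFieldTheory.Balaban1983to89.T4EtaRateDefect (idef idef_apply)
open Literature.MathematicalPhysics.QuantumFieldTheory.Balaban1983to89.T4EtaRateCoeffDefect (pull pull_apply)
open Literature.MathematicalPhysics.QuantumFieldTheory.King1986 (aK aK_pos aK_le)
open Literature.MathematicalPhysics.QuantumFieldTheory.King1986.Torus (blockOf tdistT tdistT_nonneg tdistT_symm tdistT_triangle fineOp)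
open Summit.QuantumFields.YangMills.BalabanUVNodes.N15.VectorPiece (tensorId tensorId_apply kingPr kingPrV kingPrV_eq tdistT_blockOf_sub_unitVec_le)
open Summit.QuantumFields.YangMills.BalabanUVNodes.N15.MatrixSpecies (liftBlk liftMap)
open Summit.QuantumFields.YangMills.BalabanUVNodes.N15KingModelRung.Curved (kingDOp kingDOp_apply addRight_symm_apply')

variable {d : ℕ}

/-! ## §1 The component dictionary and the slice inequality -/

section Dict

variable (L : ℕ) [NeZero L]

omit [NeZero L] in
/-- **COMPONENT DICTIONARY**: on the colour slice `f_i = f(·, i)`, the bond-colour field `S̄ₕ∂G′(1)f` at `((x, μ), i)` IS the rung's massless backward piece `(S_{−μ}D_μ f_i)(x) = (D_μ f_i)(x − e_μ)`,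
`D_μ = kingDOp L a₀ 0 K N M μ`, at the mass `a_K·N^{d+1}`. [cite: King1986, (4.5) p.670; Balaban1985BackgroundPropagators, (3.64) p.403 (`D⁻_U`: shape)] -/
theorem bBack_cgrad_cGreen_mulVec_apply (a₀ : ℝ) (K N : ℕ) [NeZero N] (M : Fin (d + 1) → ℕ) [∀ μ, NeZero (M μ)] {ι : Type} [Fintype ι] [DecidableEq ι]
    (f : Tor (fine N M) × ι → ℝ) (x : Tor (fine N M)) (μ : Fin (d + 1)) (i : ι) :
    (((bBack M N (ι := ι)) * ((cgrad M N (fun (_ : Fin (d + 1)) (_ : Tor (fine N M)) => (1 : Matrix ι ι ℝ))) * (cGreen M N (fun (_ : Fin (d + 1)) (_ : Tor (fine N M)) => (1 : Matrix ι ι ℝ)) (aK a₀ (L : ℝ) K * (N : ℝ) ^ (d + 1))))) *ᵥ f) ((x, μ), i)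
      = (pull ⇑(Equiv.addRight (unitVec (fine N M) μ)).symm ∘ₗ kingDOp L a₀ 0 K N M μ) (fun z => f (z, i)) x := by
  have hop : (cgrad M N (fun (_ : Fin (d + 1)) (_ : Tor (fine N M)) => (1 : Matrix ι ι ℝ))) * (cGreen M N (fun (_ : Fin (d + 1)) (_ : Tor (fine N M)) => (1 : Matrix ι ι ℝ)) (aK a₀ (L : ℝ) K * (N : ℝ) ^ (d + 1))) =
      (gradFlat M N * greenFlat M N (aK a₀ (L : ℝ) K * (N : ℝ) ^ (d + 1))) ⊗ₖ (1 : Matrix ι ι ℝ) := by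
    rw [cgrad_one, cGreen_one, ← Matrix.mul_kronecker_mul, Matrix.mul_one]
  rw [← Matrix.mulVec_mulVec, bBack_mulVec, hop, ← Matrix.mulVecLin_apply, mulVecLin_kronecker_one_rect, tensorId_apply]
  dsimp only
  rw [Matrix.mulVecLin_apply, LinearMap.comp_apply, pull_apply, addRight_symm_apply', kingDOp_zero_apply_eq_gradFlat, Matrix.mulVec_mulVec]

omit [NeZero L] in
/-- A colour slice localised where the field is has block size at most the field's. [folklore] -/
theorem loc_slice_le {M : Fin (d + 1) → ℕ} [∀ μ, NeZero (M μ)] (k : ℕ) {X : Type} [Fintype X] (blk : X → Tor M) {ι : Type} [Fintype ι] (f : X × ι → ℝ) (i : ι) (y' : Tor M) :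
    (BlockNorm.ofBlocks (unitTorusGeo L k M) blk).loc y' (fun z => f (z, i)) ≤ (BlockNorm.ofBlocks (unitTorusGeo L k M) (liftBlk blk ι)).loc y' f :=
  loc_ofBlocks_le (g := unitTorusGeo L k M) blk _ ((BlockNorm.ofBlocks (unitTorusGeo L k M) (liftBlk blk ι)).loc_nonneg y' f)
    fun z hz => abs_le_loc_ofBlocks (g := unitTorusGeo L k M) (liftBlk blk ι) f (x' := (z, i)) hz

end Dict

/-! ## §2 One grid: the `∂G′(1)` row read one step back -/

section OneGrid

variable (L : ℕ) [NeZero L]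

/-- ★★★ **THE ONE-GRID FLAT ROW OF `S̄ₕ∂G′(1)`, HYPOTHESIS-FREE ON KING's TORUS FAMILY** (n15-c∕237's `hD1b` ∕ `hD1b′`).  For odd `L ≥ 3` and `a₀ > 0` there are `C, δ > 0` such that for every `K ≥ 1`,
`N = L^K`, every torus `M_μ = 2L^e`, label `k` and colour type `ι`, at the mass `a_K(a₀,L,K)·N^{d+1}`: `bBack·∂·G′(1)` has the block majorant `C·e^{−δ|y−y′|_T}` (BS → BV) — n15-c∕220's `∂G′(1)` row
(`flatKernelRows_king`), the back shift moving the output point to the same or an adjacent unit block (`tdistT_blockOf_sub_unitVec_le`), cost `e^{δ}`.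
[cite: King1986, Thm 3.3 (3.7)–(3.8) pp.655–656, (4.5) p.670; Balaban1983RegularityDecay, Theorem (1.10) p.573; Balaban1985BackgroundPropagators, Thm 3.1 (3.42) p.397, (3.64) p.403 (shape)] -/
theorem flatKernelRow_gradBack_king (hLodd : Odd L) (hL : 2 ≤ L) {a₀ : ℝ} (ha₀ : 0 < a₀) :
    ∃ C δ : ℝ, 0 < C ∧ 0 < δ ∧ ∀ (K : ℕ), 1 ≤ K → ∀ (N : ℕ) [NeZero N], N = L ^ K → ∀ (e : ℕ) (M : Fin (d + 1) → ℕ) [∀ μ, NeZero (M μ)], (∀ μ, M μ = 2 * L ^ e) →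
      ∀ (k : ℕ) (ι : Type) [Fintype ι] [DecidableEq ι],
        HasMaj (BlockNorm.ofBlocks (unitTorusGeo L k M) (liftBlk (blockOf N M) ι)) (BlockNorm.ofBlocks (unitTorusGeo L k M) (liftBlk (fun b : Tor (fine N M) × Fin (d + 1) => blockOf N M b.1) ι))
          (Matrix.mulVecLin ((bBack M N (ι := ι)) * ((cgrad M N (fun (_ : Fin (d + 1)) (_ : Tor (fine N M)) => (1 : Matrix ι ι ℝ))) *
            (cGreen M N (fun (_ : Fin (d + 1)) (_ : Tor (fine N M)) => (1 : Matrix ι ι ℝ)) (aK a₀ (L : ℝ) K * (N : ℝ) ^ (d + 1))))))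
          (fun y y' => C * Real.exp (-(δ * tdistT M y y'))) := by
  obtain ⟨C, δ, hC, hδ, H⟩ := flatKernelRows_king (d := d) L hLodd hL ha₀
  refine ⟨C * Real.exp δ, δ, by positivity, hδ, ?_⟩
  intro K hK N _ hN e M _ hM k ι _ _
  obtain ⟨-, hD, -⟩ := H K hK N hN e M hM k ι
  intro y' f hf y
  have hL0 := (BlockNorm.ofBlocks (unitTorusGeo L k M) (liftBlk (blockOf N M) ι)).loc_nonneg y' f
  refine loc_ofBlocks_le (g := unitTorusGeo L k M) _ _ (mul_nonneg (by positivity) hL0) fun p hp => ?_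
  obtain ⟨⟨x, μ⟩, i⟩ := p
  -- the output point one step back lies in the same or an adjacent unit block
  have hval : (Matrix.mulVecLin ((bBack M N (ι := ι)) * ((cgrad M N (fun (_ : Fin (d + 1)) (_ : Tor (fine N M)) => (1 : Matrix ι ι ℝ))) *
      (cGreen M N (fun (_ : Fin (d + 1)) (_ : Tor (fine N M)) => (1 : Matrix ι ι ℝ)) (aK a₀ (L : ℝ) K * (N : ℝ) ^ (d + 1))))) f) ((x, μ), i) =
      (Matrix.mulVecLin ((cgrad M N (fun (_ : Fin (d + 1)) (_ : Tor (fine N M)) => (1 : Matrix ι ι ℝ))) *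
        (cGreen M N (fun (_ : Fin (d + 1)) (_ : Tor (fine N M)) => (1 : Matrix ι ι ℝ)) (aK a₀ (L : ℝ) K * (N : ℝ) ^ (d + 1)))) f) ((x - unitVec (fine N M) μ, μ), i) := by
    rw [Matrix.mulVecLin_apply, Matrix.mulVecLin_apply, ← Matrix.mulVec_mulVec, bBack_mulVec]
  rw [hval]
  have hb : blockOf N M x = y := hp
  have h1 := abs_le_loc_ofBlocks (g := unitTorusGeo L k M) (liftBlk (fun b : Tor (fine N M) × Fin (d + 1) => blockOf N M b.1) ι)
    (Matrix.mulVecLin ((cgrad M N (fun (_ : Fin (d + 1)) (_ : Tor (fine N M)) => (1 : Matrix ι ι ℝ))) *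
      (cGreen M N (fun (_ : Fin (d + 1)) (_ : Tor (fine N M)) => (1 : Matrix ι ι ℝ)) (aK a₀ (L : ℝ) K * (N : ℝ) ^ (d + 1)))) f)
    (x' := ((x - unitVec (fine N M) μ, μ), i)) (y := blockOf N M (x - unitVec (fine N M) μ)) rfl
  have h2 := hD y' f hf (blockOf N M (x - unitVec (fine N M) μ))
  have hnear : tdistT M y y' ≤ tdistT M (blockOf N M (x - unitVec (fine N M) μ)) y' + 1 := by
    have ht := tdistT_triangle M y (blockOf N M (x - unitVec (fine N M) μ)) y'
    have hs := tdistT_blockOf_sub_unitVec_le N M x μ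
    rw [hb, tdistT_symm] at hs
    linarith
  refine h1.trans (h2.trans ?_)
  have hexp : Real.exp (-(δ * tdistT M (blockOf N M (x - unitVec (fine N M) μ)) y')) ≤ Real.exp δ * Real.exp (-(δ * tdistT M y y')) := by
    rw [← Real.exp_add]; exact Real.exp_le_exp.mpr (by nlinarith)
  calc C * Real.exp (-(δ * tdistT M (blockOf N M (x - unitVec (fine N M) μ)) y')) * (BlockNorm.ofBlocks (unitTorusGeo L k M) (liftBlk (blockOf N M) ι)).loc y' f
      ≤ C * (Real.exp δ * Real.exp (-(δ * tdistT M y y'))) * (BlockNorm.ofBlocks (unitTorusGeo L k M) (liftBlk (blockOf N M) ι)).loc y' f :=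
        mul_le_mul_of_nonneg_right (mul_le_mul_of_nonneg_left hexp hC.le) hL0
    _ = C * Real.exp δ * Real.exp (-(δ * tdistT M y y')) * (BlockNorm.ofBlocks (unitTorusGeo L k M) (liftBlk (blockOf N M) ι)).loc y' f := by ring

end OneGrid

/-! ## §3 Two grids: the bundle of (Ξ-2)'s scalar defects over bond directions and colours -/

section TwoGrid

variable (L : ℕ) [NeZero L]

/-- ★★★ **THE FLAT TWO-GRID ROW OF `S̄ₕ∂G′(1)`, HYPOTHESIS-FREE ON KING's TORUS FAMILY** (n15-c∕237's `hDDb` LITERALLY).  For odd `L ≥ 3`, `a₀ > 0` and `0 < γ < 1∕2` there are `C, δ > 0` such that for every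
`K ≥ 1`, `n ≥ 1`, every torus `M_μ = 2L^e` and colour type `ι`, at the PAIRED masses `a_K·(L^K)^{d+1}` (coarse) ∕ `a_{n+K}·(L^nL^K)^{d+1}` (fine):
`S̄ₕ″∂″G″(1)P̂_S − P̂_VS̄ₕ′∂′G′(1)` has the block majorant `C·(L^K)^{−γ}·e^{−δ|y−y′|_T}` from the sharp unit-block size of coarse coloured scalars to that of fine coloured bonds — (Ξ-2)
`flatTwoGridRow_gradBack_king_scalar` at `κ = μ` on every colour slice (§1).
[cite: King1986, Prop. 3.9 (3.73) p.665, Thm 3.3 (3.7)–(3.8) pp.655–656, p.664 («x′ ∈ B^n(x)»); Balaban1983RegularityDecay, (1.9)–(1.10) p.573; Balaban1985BackgroundPropagators, Thm 3.1 (3.42)–(3.43) pp.397–398, (3.64) p.403 (shape)] -/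
theorem flatTwoGridRow_gradBack_king (hLodd : Odd L) (hL : 2 ≤ L) {a₀ : ℝ} (ha₀ : 0 < a₀) {γ : ℝ} (hγ0 : 0 < γ) (hγ1 : γ < 1 / 2) :
    ∃ C δ : ℝ, 0 < C ∧ 0 < δ ∧ ∀ (K : ℕ), 1 ≤ K → ∀ (n : ℕ), 1 ≤ n → ∀ (e : ℕ) (M : Fin (d + 1) → ℕ) [∀ μ, NeZero (M μ)], (∀ μ, M μ = 2 * L ^ e) →
      ∀ (ι : Type) [Fintype ι] [DecidableEq ι],
        HasMaj (BlockNorm.ofBlocks (unitTorusGeo L K M) (liftBlk (blockOf (L ^ K) M) ι))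
          (BlockNorm.ofBlocks (unitTorusGeo L K M) (liftBlk (fun b : Tor (fine (L ^ n * L ^ K) M) × Fin (d + 1) => blockOf (L ^ n * L ^ K) M b.1) ι))
          (idef (pull (liftMap (kingPr L K n M) ι)) (pull (liftMap (kingPrV L K n M) ι))
            (Matrix.mulVecLin ((bBack M (L ^ n * L ^ K) (ι := ι)) * ((cgrad M (L ^ n * L ^ K) (fun (_ : Fin (d + 1)) (_ : Tor (fine (L ^ n * L ^ K) M)) => (1 : Matrix ι ι ℝ))) *
              (cGreen M (L ^ n * L ^ K) (fun (_ : Fin (d + 1)) (_ : Tor (fine (L ^ n * L ^ K) M)) => (1 : Matrix ι ι ℝ)) (aK a₀ (L : ℝ) (n + K) * ((L ^ n * L ^ K : ℕ) : ℝ) ^ (d + 1))))))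
            (Matrix.mulVecLin ((bBack M (L ^ K) (ι := ι)) * ((cgrad M (L ^ K) (fun (_ : Fin (d + 1)) (_ : Tor (fine (L ^ K) M)) => (1 : Matrix ι ι ℝ))) *
              (cGreen M (L ^ K) (fun (_ : Fin (d + 1)) (_ : Tor (fine (L ^ K) M)) => (1 : Matrix ι ι ℝ)) (aK a₀ (L : ℝ) K * ((L ^ K : ℕ) : ℝ) ^ (d + 1)))))))
          (fun y y' => C * ((L : ℝ) ^ K) ^ (-γ) * Real.exp (-(δ * tdistT M y y'))) := by
  obtain ⟨C, δ, hC, hδ, H⟩ := flatTwoGridRow_gradBack_king_scalar (d := d) L hLodd hL ha₀ hγ0 hγ1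
  refine ⟨C, δ, hC, hδ, ?_⟩
  intro K hK n hn e M _ hM ι _ _
  rw [Nat.add_comm n K]
  have hθ : 0 ≤ ((L : ℝ) ^ K) ^ (-γ) := Real.rpow_nonneg (pow_nonneg (Nat.cast_nonneg L) K) _
  intro y' f hf y
  have hL0 := (BlockNorm.ofBlocks (unitTorusGeo L K M) (liftBlk (blockOf (L ^ K) M) ι)).loc_nonneg y' f
  refine loc_ofBlocks_le (g := unitTorusGeo L K M) _ _ (mul_nonneg (mul_nonneg (mul_nonneg hC.le hθ) (Real.exp_nonneg _)) hL0) fun p hp => ?_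
  obtain ⟨⟨x', μ⟩, i⟩ := p
  have hb : blockOf (L ^ n * L ^ K) M x' = y := hp
  -- the defect of the bundle at `((x′, μ), i)` is the scalar defect of the `μ`-piece on the slice `f_i` at `x′`
  have hval : (idef (pull (liftMap (kingPr L K n M) ι)) (pull (liftMap (kingPrV L K n M) ι))
        (Matrix.mulVecLin ((bBack M (L ^ n * L ^ K) (ι := ι)) * ((cgrad M (L ^ n * L ^ K) (fun (_ : Fin (d + 1)) (_ : Tor (fine (L ^ n * L ^ K) M)) => (1 : Matrix ι ι ℝ))) *
          (cGreen M (L ^ n * L ^ K) (fun (_ : Fin (d + 1)) (_ : Tor (fine (L ^ n * L ^ K) M)) => (1 : Matrix ι ι ℝ)) (aK a₀ (L : ℝ) (K + n) * ((L ^ n * L ^ K : ℕ) : ℝ) ^ (d + 1))))))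
        (Matrix.mulVecLin ((bBack M (L ^ K) (ι := ι)) * ((cgrad M (L ^ K) (fun (_ : Fin (d + 1)) (_ : Tor (fine (L ^ K) M)) => (1 : Matrix ι ι ℝ))) *
          (cGreen M (L ^ K) (fun (_ : Fin (d + 1)) (_ : Tor (fine (L ^ K) M)) => (1 : Matrix ι ι ℝ)) (aK a₀ (L : ℝ) K * ((L ^ K : ℕ) : ℝ) ^ (d + 1))))))) f ((x', μ), i) =
      (idef (pull (kingPr L K n M)) (pull (kingPr L K n M))
        (pull ⇑(Equiv.addRight (unitVec (fine (L ^ n * L ^ K) M) μ)).symm ∘ₗ kingDOp L a₀ 0 (K + n) (L ^ n * L ^ K) M μ)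
        (pull ⇑(Equiv.addRight (unitVec (fine (L ^ K) M) μ)).symm ∘ₗ kingDOp L a₀ 0 K (L ^ K) M μ)) (fun z => f (z, i)) x' := by
    rw [idef_apply, idef_apply, Pi.sub_apply, Pi.sub_apply, pull_apply, pull_apply, Matrix.mulVecLin_apply, Matrix.mulVecLin_apply,
      show liftMap (kingPrV L K n M) ι ((x', μ), i) = ((kingPr L K n M x', μ), i) from rfl, bBack_cgrad_cGreen_mulVec_apply, bBack_cgrad_cGreen_mulVec_apply]
    rfl
  rw [hval]
  have hloc : (BlockNorm.ofBlocks (unitTorusGeo L K M) (blockOf (L ^ K) M)).IsLoc y' (fun z => f (z, i)) := fun z hz => hf (z, i) hz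
  have h1 := abs_le_loc_ofBlocks (g := unitTorusGeo L K M) (blockOf (L ^ n * L ^ K) M)
    ((idef (pull (kingPr L K n M)) (pull (kingPr L K n M))
      (pull ⇑(Equiv.addRight (unitVec (fine (L ^ n * L ^ K) M) μ)).symm ∘ₗ kingDOp L a₀ 0 (K + n) (L ^ n * L ^ K) M μ)
      (pull ⇑(Equiv.addRight (unitVec (fine (L ^ K) M) μ)).symm ∘ₗ kingDOp L a₀ 0 K (L ^ K) M μ)) (fun z => f (z, i))) hb
  exact h1.trans ((H K hK n hn e M hM μ μ y' _ hloc y).trans (mul_le_mul_of_nonneg_left (loc_slice_le L K (blockOf (L ^ K) M) f i y') (mul_nonneg (mul_nonneg hC.le hθ) (Real.exp_nonneg _))))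

end TwoGrid

end Summit.QuantumFields.YangMills.BalabanUVNodes.N15.CovLandau

end
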